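/-
Copyright: the b2b-balaban T⁴-continuum CRUX team, row NE7b OWNER lineage `t4-ne7b-p1` (gen 125). Project licence.
-/
import Summits.QuantumFields.BalabanUV.T4Continuum.Spine.NE7b.SupZdKernelTorusLimit
import Summits.QuantumFields.BalabanUV.T4Continuum.Spine.NE7b.SupZdPerturbedCoarseTorusSeamRow
import Summits.QuantumFields.BalabanUV.T4Continuum.Spine.NE7b.SupTorusPerturbedCoarseFloor
import Summits.QuantumFields.BalabanUV.T4Continuum.Spine.NE7b.SupTorusPerturbedSupNorm

/-!
# THE INFINITE-VOLUME PERTURBED NEXT-SCALE HESSIAN IS THE THERMODYNAMIC LIMIT OF THE TORUS ONES: for `V : ℤ^d → [−λ, Λ]`, a SYMMETRIC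
# nonlocal part `|K(p,q)| ≤ εe^{−γ|p−q|₁}` (`γ > 1`, `ε` small), the torus `H[V∘wm_k] + K(wm·,wm·)` block columns `ψ^k` along the tower of
# coarse periods `3^k`, and ANY `ℤ^d` objects of the `H + K` column — decaying block columns `Ψ^K` with their equations, the coarse operator
# `T_K(b,c) = (n+1)^{−d}Σ_{q ∈ B n b}Ψ^K_c(q)` symmetric with a floor and decay, and ANY decaying right inverse `N_K` ((222)∕(232)∕(234) supply
# all of these) —: for every `b, b′ ∈ ℤ^d`, `(T^{tor}_{K,k})⁻¹(σ_k b, σ_k b′) → N_K(b,b′)` as `k → ∞`, with an explicit exponential rate in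
# `3^k` — the torus next-scale Hessians `(n+1)^d(T^{tor}_{K,k})⁻¹` of the perturbed road CONVERGE to the infinite-volume one.  (242) with
# `Tt_k = T^{tor}_{K,k}` ((165) symmetry, (166) floor, (165) decay at (131)'s rate `κ`), `T = T_K`, `N = N_K`, and (240)'s row seam with
# (167)'s uniform sup bound for the torus columns (row NE7b, node U5c; (165)∕(166)∕(167)∕(240)∕(242) BY NAME; [folklore])

Cell `pub-balaban`, sub-cell `t4`, spine estimate NE7b (`T4WeightBudget.RelWeightBound`; the cell's OWN estimate — NOT PRINTED in
[Bałaban 1983–89], NOT PROVED).  Crux-route work under `Spine/NE7b/` by the row OWNER (`t4-ne7b-p1` gen 125, file (243)) under FREEZE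
(0)'s crux-prover clause; NOTHING of Bałaban's is named as a Lean object, valued or asserted; no `T4Continuum/Support` leaf typed; no `def`,
no notation (all operators DISPLAYED; `Ψ^K`, `N_K` and the torus columns are ANY families with the displayed properties); zero `sorry`.
Imports (BY NAME): the OWNER's (242) `…SupZdKernelTorusLimit` (`torus_inverses_tendsto`), (240) `…SupZdPerturbedCoarseTorusSeamRow`
(`zd_perturbed_coarse_seam_row`), (166) `…SupTorusPerturbedCoarseFloor` (`perturbed_coarse_floor`; through it (165) `perturbed_schur_symm`,
`perturbed_schur_entry_le`, (131) `SupTorusHessianCombesThomas.exists_rate`), (167) `…SupTorusPerturbedSupNorm` (`perturbed_supNorm_bound`),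
(180) `torusDist_le_l1`, (222) `K_pos`, `SupTorusPerturbedResponse.kernelSum_anti`.

WHY (located).  Item (b) of § [NE7bP1-G124-HANDOFF]: identify the thermodynamic limit of the `H + K` tower's next-scale Hessians with
`N_K`.  Everything is in place: the torus kernels `T^{tor}_{K,k}` are symmetric, uniformly coercive and uniformly local ((165)∕(166), with
(131)'s rate `κ` and (166)'s smallness `εK_{γ−1} ≤ (min(2,a) − λ)∕4`), the torus columns are uniformly bounded ((167)), the row seam against
`T_K∘wm_k` is (240), and (242) is the abstract limit theorem.  This file only substitutes and weakens constants to data-free ones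
(`γ_t = 1∕(36^d(4d + a + Λ + (min(2,a)−λ)∕4))`, `C_t = ((min(2,a)−λ)∕4)⁻¹e^{2dκ}`).

WHAT IS PROVED ([folklore]): §1 `torus_kernel_class` (the window reading of a `ℤ^d` kernel is in the torus class; the lattice sum's
monotonicity is (SupTorusPerturbedResponse) `kernelSum_anti`); §2 THE END **`zd_perturbed_hessian_torus_limit`** (`∃ C₀ C_P δ₀ ε₀ > 0` from `(d, a, λ, Λ, γ)`: for ALL
`ε ≤ ε₀`, `0 < μ < min(δ₀, γ)` under (240)'s two smallness conditions and `εK_{γ−1} ≤ (min(2,a)−λ)∕4`, ALL letters `γ_z, C_z, C_Ψ, C_N, ν` of the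
`ℤ^d` objects: `∃ c₁ δ₁ c₂ δ₂ > 0` such that for ALL `n`, `V`, symmetric `K` of the class, ANY `Ψ^K, N_K` with the displayed properties and ANY
torus column family `ψ^k`: the explicit bound beyond the window radius and `(T^{tor}_{K,k})⁻¹(σ_k b, σ_k b′) → N_K(b,b′)`); §3 toy.

HONEST (what this is NOT).  The identification of the next-scale HESSIANS; the torus → `ℤ^d` limits of the perturbed response and
covariance ((204)∕(206)'s twins) are by-name sequels; `d ≥ 3`; `K` symmetric; scalar skeleton ((A3), NC-NE7b-α UNRULED); nothing of the
covariant propagators of [B4]–[B6]; nothing of Bałaban's asserted.  BY-NAME EFFECT ON THE WALL: NONE.  NE7b NOT PRINTED ∕ NOT PROVED;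
spine PROVED 0∕9; rung (B)+1 — the programme's measures remain FINITE-torus statements, whose next-scale Hessians are here shown to
converge to the infinite-volume one; NOT the mass gap, NOT Clay.  HONEST DEPENDENCY: continuum YM on T⁴ ⇐ BetaPertH ∧ nine spine
estimates (0∕9 proved); BetaPertH ⇐ (D1) ∧ (D4) ∧ CAP+tail; G-an2-4 gates asym, D1 and NE2∕3∕4.
-/

set_option autoImplicit false

noncomputable section

namespace Summit.QuantumFields.BalabanUV.T4Continuum.NE7b.SupZdPerturbedHessianTorusLimit

open Real Filter Topology
open Literature.MathematicalPhysics.QuantumFieldTheory.Balaban1983to89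
open B6QGQLower276 (X e blk B chart mem_B sum_B sum_B_const blk_chart)
open Beta (Site siteOf windowMap siteOf_windowMap)
open SupZdPropagatorProfile (torusDist_le_l1)
open SupZdPerturbedColumn (K_pos)
open SupTorusHessianCombesThomas (exists_rate)
open SupTorusPerturbedColumns (perturbed_schur_symm perturbed_schur_entry_le)
open SupTorusPerturbedCoarseFloor (perturbed_coarse_floor)
open SupTorusPerturbedSupNorm (perturbed_supNorm_bound)
open SupTorusPerturbedResponse (kernelSum_anti)
open SupZdPerturbedCoarseTorusSeamRow (zd_perturbed_coarse_seam_row)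
open SupZdKernelTorusLimit (torus_inverses_tendsto)

variable {d : ℕ}

/-! ## §1. Bookkeeping -/

/-- **THE WINDOW READING OF A `ℤ^d` KERNEL IS IN THE TORUS CLASS**: `|K(p,q)| ≤ εe^{−γ|p−q|₁}`, `γ ≥ 0` ⟹ `|K(wm x, wm z)| ≤ εe^{−γρ(x,z)}` (the
torus distance is below the window distance). [folklore] -/
theorem torus_kernel_class (N : ℕ) [NeZero N] {ε γ : ℝ} (hγ : 0 ≤ γ) (K : X d → X d → ℝ)
    (hK : ∀ p q, |K p q| ≤ ε * exp (-(γ * ∑ i, (((p i - q i).natAbs : ℕ) : ℝ)))) (x z : Site d N) :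
    |K (windowMap d N x) (windowMap d N z)| ≤ ε * exp (-(γ * ∑ i, (((x i - z i).valMinAbs.natAbs : ℕ) : ℝ))) := by
  have hε : 0 ≤ ε := by
    have h := (abs_nonneg _).trans (hK 0 0)
    exact le_of_mul_le_mul_right (by rw [zero_mul]; exact h) (exp_pos _)
  refine (hK _ _).trans (mul_le_mul_of_nonneg_left (exp_le_exp.2 (neg_le_neg (mul_le_mul_of_nonneg_left ?_ hγ))) hε)
  have h := torusDist_le_l1 (d := d) N (windowMap d N x) (windowMap d N z)
  simpa only [siteOf_windowMap] using h

/-! ## §2. THE END: the torus perturbed next-scale Hessians converge to the infinite-volume one -/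

/-- **HEADLINE — `(T^{tor}_{K,k})⁻¹(σ_k b, σ_k b′) → N_K(b,b′)`.**  `d ≥ 3`, `a > 0`, `λ < min(2,a)`, `Λ ≥ 0`, `γ > 1` ⟹ `∃ C₀ C_P δ₀ ε₀ > 0` (from
`(d, a, λ, Λ, γ)`) such that for ALL `0 ≤ ε ≤ ε₀` and `0 < μ < min(δ₀, γ)` under (240)'s two smallness conditions and `εK_{γ−1} ≤ (min(2,a)−λ)∕4`,
and ALL letters `γ_z, C_z > 0`, `C_Ψ, C_N ≥ 0`, `ν > 0`: `∃ c₁ δ₁ c₂ δ₂ > 0` such that for ALL `n`, `V : ℤ^d → [−λ, Λ]`, SYMMETRIC `K` of the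
class, ANY `Ψ^K` (perturbed block-column equations, `|Ψ^K| ≤ C_Ψ`) with `T_K` symmetric, `γ_z`-coercive on finite supports and `C_ze^{−μ}`-local,
ANY `N_K` (`|N_K| ≤ C_Ne^{−ν}`, `T_KN_K = 1`), and ANY torus block columns `ψ^k` of `H[V∘wm_k] + K(wm·,wm·)`: for all `b, b′` and all
`k ≥ 2(|b|₁+|b′|₁)+1` the explicit bound of (242), and `(T^{tor}_{K,k})⁻¹(σ_k b, σ_k b′) → N_K(b,b′)`. [folklore] -/
theorem zd_perturbed_hessian_torus_limit (hd : 3 ≤ d) (a : ℝ) (ha : 0 < a) {lam Lam γ : ℝ} (hlam : lam < min 2 a) (hLam : 0 ≤ Lam)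
    (hγ : 1 < γ) :
    ∃ C₀ CP δ₀ ε₀ : ℝ, 0 < C₀ ∧ 0 < CP ∧ 0 < δ₀ ∧ 0 < ε₀ ∧
    ∀ (ε μ : ℝ), 0 ≤ ε → ε ≤ ε₀ → 0 < μ → μ < δ₀ → μ < γ →
      ε * (2 * (1 - exp (-γ))⁻¹) ^ d * C₀ ≤ 1 / 2 →
      (CP * (2 * (1 - exp (-(δ₀ - μ)))⁻¹) ^ d) * (ε * exp (μ * d) * (2 * (1 - exp (-(γ - μ)))⁻¹) ^ d) ≤ 1 / 2 →
      ε * (2 * (1 - exp (-(γ - 1)))⁻¹) ^ d ≤ (min 2 a - lam) / 4 →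
    ∀ (γz Cz CΨ CN ν : ℝ), 0 < γz → 0 < Cz → 0 ≤ CΨ → 0 ≤ CN → 0 < ν →
    ∃ c₁ δ₁ c₂ δ₂ : ℝ, 0 < c₁ ∧ 0 < δ₁ ∧ 0 < c₂ ∧ 0 < δ₂ ∧
    ∀ (n : ℕ) (V : X d → ℝ), (∀ p, -lam ≤ V p) → (∀ p, V p ≤ Lam) →
    ∀ (K : X d → X d → ℝ), (∀ p q, |K p q| ≤ ε * exp (-(γ * ∑ i, (((p i - q i).natAbs : ℕ) : ℝ)))) → (∀ p q, K p q = K q p) →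
    ∀ (ΨK N : X d → X d → ℝ),
      (∀ c p, ((n : ℝ) + 1) ^ 2 * ∑ μ', (2 * ΨK c p - ΨK c (p + e μ') - ΨK c (p - e μ'))
        + a / ((n : ℝ) + 1) ^ d * ∑ q ∈ B n (blk n p), ΨK c q + V p * ΨK c p + ∑' q : X d, K p q * ΨK c q
          = if blk n p = c then 1 else 0) →
      (∀ c p, |ΨK c p| ≤ CΨ) →
      (∀ b c, (((n : ℝ) + 1) ^ d)⁻¹ * ∑ q ∈ B n b, ΨK c q = (((n : ℝ) + 1) ^ d)⁻¹ * ∑ q ∈ B n c, ΨK b q) →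
      (∀ (S : Finset (X d)) (g : X d → ℝ), (∀ b, b ∉ S → g b = 0) →
        γz * ∑ b ∈ S, g b ^ 2 ≤ ∑ b ∈ S, g b * ∑ c ∈ S, ((((n : ℝ) + 1) ^ d)⁻¹ * ∑ q ∈ B n b, ΨK c q) * g c) →
      (∀ b c, |(((n : ℝ) + 1) ^ d)⁻¹ * ∑ q ∈ B n b, ΨK c q| ≤ Cz * exp (-(μ * ∑ i, (((b i - c i).natAbs : ℕ) : ℝ)))) →
      (∀ b c, |N b c| ≤ CN * exp (-(ν * ∑ i, (((b i - c i).natAbs : ℕ) : ℝ)))) →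
      (∀ b c, ∑' b' : X d, ((((n : ℝ) + 1) ^ d)⁻¹ * ∑ q ∈ B n b, ΨK b' q) * N b' c = if b = c then 1 else 0) →
    ∀ (ψ : (k : ℕ) → Site d (3 ^ k) → Site d ((n + 1) * 3 ^ k) → ℝ),
      (∀ (k : ℕ) (y' : Site d (3 ^ k)) (x : Site d ((n + 1) * 3 ^ k)),
        ((n : ℝ) + 1) ^ 2 * ∑ μ', (2 * ψ k y' x - ψ k y' (x + siteOf d ((n + 1) * 3 ^ k) (e μ'))
          - ψ k y' (x - siteOf d ((n + 1) * 3 ^ k) (e μ')))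
        + a / ((n : ℝ) + 1) ^ d * ∑ q ∈ B n (blk n (windowMap d ((n + 1) * 3 ^ k) x)), ψ k y' (siteOf d ((n + 1) * 3 ^ k) q)
        + V (windowMap d ((n + 1) * 3 ^ k) x) * ψ k y' x
        + ∑ z, K (windowMap d ((n + 1) * 3 ^ k) x) (windowMap d ((n + 1) * 3 ^ k) z) * ψ k y' z
        = if siteOf d (3 ^ k) (blk n (windowMap d ((n + 1) * 3 ^ k) x)) = y' then 1 else 0) →
    ∀ b b' : X d,
      (∀ k : ℕ, 2 * (∑ i, (b i).natAbs + ∑ i, (b' i).natAbs) + 1 ≤ k →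
        |(Matrix.of fun y y' : Site d (3 ^ k) => (((n : ℝ) + 1) ^ d)⁻¹
            * ∑ z : Fin d → Fin (n + 1), ψ k y' (siteOf d ((n + 1) * 3 ^ k) (chart n (windowMap d (3 ^ k) y) z)))⁻¹
            (siteOf d (3 ^ k) b) (siteOf d (3 ^ k) b') - N b b'|
          ≤ c₁ * exp (-(δ₁ * ((((3 ^ k : ℕ) : ℝ)
              - (4 + ∑ i, (((b i).natAbs : ℕ) : ℝ) + ∑ i, (((b' i).natAbs : ℕ) : ℝ))) / 2)))
          + (max (max c₂ 1) CN) ^ 2 * (2 * (1 - exp (-(min δ₂ ν)))⁻¹) ^ d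
            * (2 * max Cz 1 * (2 * (1 - exp (-(min δ₂ ν / 2)))⁻¹) ^ d
              * (2 * exp (-(min δ₂ ν / 2 * ((1 / 2) * ((3 ^ k : ℕ) : ℝ)
                - (1 / 2 + ∑ i, (((b i).natAbs : ℕ) : ℝ) + ∑ i, (((b' i).natAbs : ℕ) : ℝ)))))))) ∧
      Tendsto (fun k : ℕ => (Matrix.of fun y y' : Site d (3 ^ k) => (((n : ℝ) + 1) ^ d)⁻¹
          * ∑ z : Fin d → Fin (n + 1), ψ k y' (siteOf d ((n + 1) * 3 ^ k) (chart n (windowMap d (3 ^ k) y) z)))⁻¹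
          (siteOf d (3 ^ k) b) (siteOf d (3 ^ k) b')) atTop (𝓝 (N b b')) := by
  classical
  have hd0 : (0 : ℝ) ≤ d := Nat.cast_nonneg d
  have hγ0 : 0 < γ := by linarith
  have hm0 : 0 < min 2 a - lam := by linarith
  -- the torus letters: (131)'s rate, (167)'s sup bound, (240)'s constants
  obtain ⟨κ, hκ0, hκ1, hκm⟩ := exists_rate (d := d) a ha.le hm0
  have hκγ : κ < γ := lt_of_le_of_lt hκ1 hγ
  obtain ⟨ε₀, Csup, hε₀, hCsup, H167⟩ := perturbed_supNorm_bound (d := d) hd a ha hlam hLam hγ0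
  obtain ⟨C₀, CP, δ₀, hC₀, hCP, hδ₀, H240⟩ := zd_perturbed_coarse_seam_row (d := d) hd a ha hlam hLam
  refine ⟨C₀, CP, δ₀, ε₀, hC₀, hCP, hδ₀, hε₀, ?_⟩
  intro ε μ hε hεε₀ hμ hμδ hμγ hs1 hs2 hεs γz Cz CΨ CN ν hγz hCz hCΨ hCN hν
  -- kernel sums at the rates in play
  have hKγ : 0 < (2 * (1 - exp (-γ))⁻¹) ^ d := K_pos (d := d) hγ0
  have hK0 : 0 < (2 * (1 - exp (-(δ₀ - μ)))⁻¹) ^ d := K_pos (d := d) (sub_pos.2 hμδ)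
  have hKh : 0 < (2 * (1 - exp (-(μ / 2)))⁻¹) ^ d := K_pos (d := d) (by linarith)
  have hKγ2 : 0 < (2 * (1 - exp (-(γ / 2)))⁻¹) ^ d := K_pos (d := d) (by linarith)
  have hr1 : ε * (2 * (1 - exp (-(γ - κ)))⁻¹) ^ d ≤ (min 2 a - lam) / 4 :=
    (mul_le_mul_of_nonneg_left (kernelSum_anti (d := d) (by linarith) (by linarith)) hε).trans hεs
  have hr2 : ε * (2 * (1 - exp (-γ))⁻¹) ^ d ≤ (min 2 a - lam) / 4 :=
    (mul_le_mul_of_nonneg_left (kernelSum_anti (d := d) (by linarith) (by linarith)) hε).trans hεs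
  have hm : ε * (2 * (1 - exp (-(γ - κ)))⁻¹) ^ d < min 2 a - lam - 2 * d * κ ^ 2 - a * (exp (2 * d * κ) - 1) := by linarith
  have hfl : (min 2 a - lam) / 4 ≤ min 2 a - lam - 2 * d * κ ^ 2 - a * (exp (2 * d * κ) - 1)
      - ε * (2 * (1 - exp (-(γ - κ)))⁻¹) ^ d := by linarith
  have hlam' : lam + ε * (2 * (1 - exp (-γ))⁻¹) ^ d ≤ min 2 a := by linarith
  -- data-free torus floor and decay constants
  obtain ⟨γt, hγt⟩ : ∃ γt : ℝ, γt = 1 / ((36 : ℝ) ^ d * (4 * d + a + Lam + (min 2 a - lam) / 4)) := ⟨_, rfl⟩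
  obtain ⟨Ct, hCt⟩ : ∃ Ct : ℝ, Ct = ((min 2 a - lam) / 4)⁻¹ * exp (2 * d * κ) := ⟨_, rfl⟩
  have hγt0 : 0 < γt := by rw [hγt]; positivity
  have hCt0 : 0 < Ct := by rw [hCt]; positivity
  -- (240)'s seam constant with `B_u = C_sup`, `C_Φ = C_Ψ`
  obtain ⟨Cs, hCs⟩ : ∃ Cs : ℝ, Cs = ((2 * (CP * (2 * (1 - exp (-(δ₀ - μ)))⁻¹) ^ d) * (2 * (1 - exp (-(μ / 2)))⁻¹) ^ d)
        * (ε * (2 * (1 - exp (-(γ / 2)))⁻¹) ^ d * exp (γ / 2 * d) * CΨ)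
      + (2 * (CP * (2 * (1 - exp (-(δ₀ - μ)))⁻¹) ^ d) * (2 * (1 - exp (-(μ / 2)))⁻¹) ^ d)
        * ((2 + 2 * (|lam| + Lam) * (2 * (CP * (2 * (1 - exp (-(δ₀ - μ)))⁻¹) ^ d) * (2 * (1 - exp (-(μ / 2)))⁻¹) ^ d))
          * (1 + 2 * (ε * (2 * (1 - exp (-γ))⁻¹) ^ d) * (Csup * 1 + CΨ)))) := ⟨_, rfl⟩
  have hCs0 : 0 < Cs := by
    rw [hCs]
    have h1 : 0 ≤ (2 * (CP * (2 * (1 - exp (-(δ₀ - μ)))⁻¹) ^ d) * (2 * (1 - exp (-(μ / 2)))⁻¹) ^ d)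
        * (ε * (2 * (1 - exp (-(γ / 2)))⁻¹) ^ d * exp (γ / 2 * d) * CΨ) := by positivity
    have h2 : 0 < (2 * (CP * (2 * (1 - exp (-(δ₀ - μ)))⁻¹) ^ d) * (2 * (1 - exp (-(μ / 2)))⁻¹) ^ d)
        * ((2 + 2 * (|lam| + Lam) * (2 * (CP * (2 * (1 - exp (-(δ₀ - μ)))⁻¹) ^ d) * (2 * (1 - exp (-(μ / 2)))⁻¹) ^ d))
          * (1 + 2 * (ε * (2 * (1 - exp (-γ))⁻¹) ^ d) * (Csup * 1 + CΨ))) := by positivity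
    linarith
  obtain ⟨c₁, δ₁, c₂, δ₂, hc₁, hδ₁, hc₂, hδ₂, H242⟩ := torus_inverses_tendsto (d := d) (γt := γt) (Ct := Ct) (κ := κ) (γz := γz)
    (Cz := Cz) (δz := μ) (Cs := Cs) (δs := μ / 2) hγt0 hCt0 hκ0 hγz hCz hμ hCs0 (by linarith)
  refine ⟨c₁, δ₁, c₂, δ₂, hc₁, hδ₁, hc₂, hδ₂, ?_⟩
  intro n V hV hV' K hK hKs ΨK N hA3 hA4 hD1 hE1 hE0 hC1 hC2 ψ hψ b b'
  -- the torus data for each level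
  have hVt : ∀ (k : ℕ) (x : Site d ((n + 1) * 3 ^ k)), -lam ≤ V (windowMap d ((n + 1) * 3 ^ k) x) := fun k x => hV _
  have hVt' : ∀ (k : ℕ) (x : Site d ((n + 1) * 3 ^ k)), V (windowMap d ((n + 1) * 3 ^ k) x) ≤ Lam := fun k x => hV' _
  have hKt : ∀ (k : ℕ) (x z : Site d ((n + 1) * 3 ^ k)), |K (windowMap d ((n + 1) * 3 ^ k) x) (windowMap d ((n + 1) * 3 ^ k) z)|
      ≤ ε * exp (-(γ * ∑ i, (((x i - z i).valMinAbs.natAbs : ℕ) : ℝ))) := fun k x z => torus_kernel_class _ hγ0.le K hK x z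
  have hKt₀ : ∀ (k : ℕ) (x z : Site d ((n + 1) * 3 ^ k)), |K (windowMap d ((n + 1) * 3 ^ k) x) (windowMap d ((n + 1) * 3 ^ k) z)|
      ≤ ε₀ * exp (-(γ * ∑ i, (((x i - z i).valMinAbs.natAbs : ℕ) : ℝ))) := fun k x z =>
    (hKt k x z).trans (mul_le_mul_of_nonneg_right hεε₀ (exp_pos _).le)
  have hKts : ∀ (k : ℕ) (x z : Site d ((n + 1) * 3 ^ k)), K (windowMap d ((n + 1) * 3 ^ k) x) (windowMap d ((n + 1) * 3 ^ k) z)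
      = K (windowMap d ((n + 1) * 3 ^ k) z) (windowMap d ((n + 1) * 3 ^ k) x) := fun k x z => hKs _ _
  -- the torus columns are uniformly bounded ((167), source `|𝟙| ≤ 1`)
  have hψB : ∀ k y' x, |ψ k y' x| ≤ Csup * 1 := fun k y' x =>
    H167 n (3 ^ k) (fun x => V (windowMap d ((n + 1) * 3 ^ k) x)) (hVt k) (hVt' k)
      (fun x z => K (windowMap d ((n + 1) * 3 ^ k) x) (windowMap d ((n + 1) * 3 ^ k) z)) (hKt₀ k) 1 (ψ k y')
      (fun x => if siteOf d (3 ^ k) (blk n (windowMap d ((n + 1) * 3 ^ k) x)) = y' then (1 : ℝ) else 0)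
      (fun x => by split_ifs <;> simp) (hψ k y') x
  -- the four hypotheses of (242) on the torus kernels
  have hTts : ∀ (k : ℕ) (y y' : Site d (3 ^ k)), (((n : ℝ) + 1) ^ d)⁻¹
      * ∑ z : Fin d → Fin (n + 1), ψ k y' (siteOf d ((n + 1) * 3 ^ k) (chart n (windowMap d (3 ^ k) y) z))
      = (((n : ℝ) + 1) ^ d)⁻¹
      * ∑ z : Fin d → Fin (n + 1), ψ k y (siteOf d ((n + 1) * 3 ^ k) (chart n (windowMap d (3 ^ k) y') z)) := fun k y y' =>
    perturbed_schur_symm n a (3 ^ k) (fun x => V (windowMap d ((n + 1) * 3 ^ k) x))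
      (fun x z => K (windowMap d ((n + 1) * 3 ^ k) x) (windowMap d ((n + 1) * 3 ^ k) z)) (ψ k) (hψ k) (hKts k) y y'
  have hTtfloor : ∀ (k : ℕ) (g : Site d (3 ^ k) → ℝ), γt * ∑ y, g y ^ 2 ≤ ∑ y, g y * ∑ y', ((((n : ℝ) + 1) ^ d)⁻¹
      * ∑ z : Fin d → Fin (n + 1), ψ k y' (siteOf d ((n + 1) * 3 ^ k) (chart n (windowMap d (3 ^ k) y) z))) * g y' := by
    intro k g
    have h := perturbed_coarse_floor n a (3 ^ k) ha hLam hε hγ0 hlam' (fun x => V (windowMap d ((n + 1) * 3 ^ k) x)) (hVt k)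
      (hVt' k) (fun x z => K (windowMap d ((n + 1) * 3 ^ k) x) (windowMap d ((n + 1) * 3 ^ k) z)) (hKts k) (hKt k) (ψ k) (hψ k) g
    refine le_trans (mul_le_mul_of_nonneg_right ?_ (Finset.sum_nonneg fun _ _ => sq_nonneg _)) h
    rw [hγt]
    exact one_div_le_one_div_of_le (by positivity) (mul_le_mul_of_nonneg_left (by linarith) (by positivity))
  have hTtd : ∀ (k : ℕ) (y y' : Site d (3 ^ k)), |(((n : ℝ) + 1) ^ d)⁻¹
      * ∑ z : Fin d → Fin (n + 1), ψ k y' (siteOf d ((n + 1) * 3 ^ k) (chart n (windowMap d (3 ^ k) y) z))|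
      ≤ Ct * exp (-(κ * ∑ i, (((y i - y' i).valMinAbs.natAbs : ℕ) : ℝ))) := by
    intro k y y'
    have h := perturbed_schur_entry_le n a (3 ^ k) ha.le hκ0.le hκ1 hκγ hε hm (fun x => V (windowMap d ((n + 1) * 3 ^ k) x))
      (hVt k) (fun x z => K (windowMap d ((n + 1) * 3 ^ k) x) (windowMap d ((n + 1) * 3 ^ k) z)) (hKt k) (ψ k) (hψ k) y y'
    refine h.trans (mul_le_mul_of_nonneg_right ?_ (exp_pos _).le)
    rw [hCt]
    exact mul_le_mul_of_nonneg_right (inv_anti₀ (by positivity) hfl) (exp_pos _).le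
  have hseam : ∀ (k : ℕ) (y y' : Site d (3 ^ k)), |(((n : ℝ) + 1) ^ d)⁻¹
      * ∑ z : Fin d → Fin (n + 1), ψ k y' (siteOf d ((n + 1) * 3 ^ k) (chart n (windowMap d (3 ^ k) y) z))
      - (((n : ℝ) + 1) ^ d)⁻¹ * ∑ q ∈ B n (windowMap d (3 ^ k) y), ΨK (windowMap d (3 ^ k) y') q|
      ≤ Cs * exp (-(μ / 2 * max 0 ((((3 ^ k : ℕ) : ℝ) / 2 - 2 - ∑ i, ((((y i).valMinAbs).natAbs : ℕ) : ℝ)) / 2))) := by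
    intro k y y'
    have h := (H240 n k V hV hV' ε γ μ hε hμ hμδ hμγ hs1 hs2 K hK (ψ k) (Csup * 1) (hψB k) (hψ k) ΨK CΨ hA4 hA3 y y').2
    rw [← hCs] at h
    exact h
  exact H242 (fun b c => (((n : ℝ) + 1) ^ d)⁻¹ * ∑ q ∈ B n b, ΨK c q) N CN ν hCN hν hD1 hE1 hE0 hC1 hC2
    (fun k y y' => (((n : ℝ) + 1) ^ d)⁻¹
      * ∑ z : Fin d → Fin (n + 1), ψ k y' (siteOf d ((n + 1) * 3 ^ k) (chart n (windowMap d (3 ^ k) y) z)))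
    hTts hTtfloor hTtd hseam b b'

/-! ## §3. Toy -/

/-- Toy (`d = 3`, `a = 1`, `λ = 0`, `Λ = 1`, `γ = 2`): the four tree constants exist. -/
example : ∃ C₀ CP δ₀ ε₀ : ℝ, 0 < C₀ ∧ 0 < CP ∧ 0 < δ₀ ∧ 0 < ε₀ :=
  let ⟨C₀, CP, δ₀, ε₀, h1, h2, h3, h4, _⟩ := zd_perturbed_hessian_torus_limit (d := 3) le_rfl 1 one_pos (lam := 0) (Lam := 1) (γ := 2)
    (by rw [min_eq_right (by norm_num : (1 : ℝ) ≤ 2)]; norm_num) zero_le_one (by norm_num)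
  ⟨C₀, CP, δ₀, ε₀, h1, h2, h3, h4⟩

end Summit.QuantumFields.BalabanUV.T4Continuum.NE7b.SupZdPerturbedHessianTorusLimit
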